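import Summits.CriticalPhenomena.Ising3DConformalLimit.Theorems.HyperoctahedralRPExistsScaleCovariantLimitFunnelDoublingIffAxisRate
import HarnessLib

/-!
# Head-sum bound for positive sequences under a level envelope and block halving
(helper for the √n-doubling partial of item 6150, line folded-current-repulsion of crux 1981,
item stmt-CriticalPhenomena-1981; stub `logConvex_head_sum`)

For a positive sequence `G` with the LEVEL envelope `k·G(k) ≤ C` (`k ≥ 1`) and the BLOCK-HALVING property
`G(k + j·b) ≤ 2^{-j} G(k)` (`1 ≤ k`, `k + j·b ≤ n`, block length `b ≥ 1`), the head sum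
`∑_{k=1}^{n} k·G(k)` is at most `6·C·b`. Real-variable only (no lattice model).

Mechanism. Pointwise, with `q = (k-1)/b`: for `q = 0` the envelope gives `k G(k) ≤ C`; for `q = j+1 ≥ 1`
write `k = k₁ + j·b` with `b+1 ≤ k₁ ≤ 2b`, so `k ≤ (j+1) k₁` and halving plus the envelope at `k₁` give
`k G(k) ≤ (j+1) 2^{-j} C`; both are `≤ C·(2q+1)·2^{-q}`. Summing fibrewise over `q` (each fibre has at
most `b` elements) and using `∑_{q<N} (2q+1) 2^{-q} = 6 − (4N+6) 2^{-N} ≤ 6` gives the claim. [folklore]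
-/

namespace Summit.CriticalPhenomena.Ising3DConformalLimit.Cruxes.ExistsScaleCovariantLimit.FoldedCurrentRepulsion

/-- Closed form of the weight sum: `∑_{q<N} (2q+1)·2^{-q} = 6 − (4N+6)·2^{-N}`. [folklore] -/
private lemma headSum_weight_sum_eq (N : ℕ) :
    ∑ q ∈ Finset.range N, (2 * (q : ℝ) + 1) * (1 / 2 : ℝ) ^ q
      = 6 - (4 * (N : ℝ) + 6) * (1 / 2 : ℝ) ^ N := by
  induction N with
  | zero => norm_num
  | succ N ih =>
    rw [Finset.sum_range_succ, ih, pow_succ]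
    push_cast
    ring

/-- The weight sum is at most `6`: `∑_{q<N} (2q+1)·2^{-q} ≤ 6`. [folklore] -/
private lemma headSum_weight_sum_le (N : ℕ) :
    ∑ q ∈ Finset.range N, (2 * (q : ℝ) + 1) * (1 / 2 : ℝ) ^ q ≤ 6 := by
  rw [headSum_weight_sum_eq]
  exact sub_le_self _ (by positivity)

/-- Pointwise bound: under the level envelope and block halving, for `1 ≤ k ≤ n` and `q = (k-1)/b`,
`k·G(k) ≤ C·(2q+1)·2^{-q}` (envelope for `q = 0`; for `q = j+1`, halve `j` blocks down to
`k₁ = k - j·b ∈ [b+1, 2b]`, where `k ≤ (j+1)·k₁`). [folklore] -/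
private lemma headSum_pointwise (G : ℕ → ℝ) (C : ℝ) (b n k : ℕ) (hG : ∀ k, 0 < G k) (hb : 1 ≤ b)
    (henv : ∀ k : ℕ, 1 ≤ k → (k : ℝ) * G k ≤ C)
    (hhalf : ∀ k j : ℕ, 1 ≤ k → k + j * b ≤ n → G (k + j * b) ≤ (1 / 2 : ℝ) ^ j * G k)
    (hk1 : 1 ≤ k) (hkn : k ≤ n) :
    (k : ℝ) * G k ≤ C * ((2 * (((k - 1) / b : ℕ) : ℝ) + 1) * (1 / 2 : ℝ) ^ ((k - 1) / b)) := by
  have hC : 0 ≤ C := by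
    have h1 := henv 1 le_rfl
    have h2 := hG 1
    simp only [Nat.cast_one, one_mul] at h1
    linarith
  have hdm : (k - 1) / b * b + (k - 1) % b = k - 1 := Nat.div_add_mod' (k - 1) b
  have hmod : (k - 1) % b < b := Nat.mod_lt _ (by omega)
  generalize hq : (k - 1) / b = q at hdm ⊢
  rcases Nat.eq_zero_or_pos q with hq0 | hqpos
  · -- first block: the envelope alone
    subst hq0
    have h := henv k hk1
    simpa using h
  · -- `q = j + 1`: halve `j` blocks down to `k₁ ∈ [b+1, 2b]`
    obtain ⟨j, rfl⟩ : ∃ j, q = j + 1 := ⟨q - 1, by omega⟩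
    have hjb : (j + 1) * b = j * b + b := by ring
    obtain ⟨k₁, hk, hk₁b⟩ : ∃ k₁, k = k₁ + j * b ∧ b + 1 ≤ k₁ :=
      ⟨k - j * b, by omega, by omega⟩
    have hk₁1 : 1 ≤ k₁ := by omega
    have hGk : G k ≤ (1 / 2 : ℝ) ^ j * G k₁ := by
      have h := hhalf k₁ j hk₁1 (by omega)
      rwa [← hk] at h
    have henv₁ : (k₁ : ℝ) * G k₁ ≤ C := henv k₁ hk₁1
    have hnat : k ≤ (j + 1) * k₁ := by
      have h1 : j * b ≤ j * k₁ := Nat.mul_le_mul_left j (by omega)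
      have h2 : (j + 1) * k₁ = j * k₁ + k₁ := by ring
      omega
    have hkk₁ : (k : ℝ) ≤ ((j : ℝ) + 1) * k₁ := by exact_mod_cast hnat
    have hp : 0 < (1 / 2 : ℝ) ^ j := by positivity
    calc (k : ℝ) * G k ≤ (k : ℝ) * ((1 / 2 : ℝ) ^ j * G k₁) :=
          mul_le_mul_of_nonneg_left hGk (Nat.cast_nonneg k)
      _ ≤ ((j : ℝ) + 1) * k₁ * ((1 / 2 : ℝ) ^ j * G k₁) :=
          mul_le_mul_of_nonneg_right hkk₁ (mul_nonneg hp.le (hG k₁).le)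
      _ = ((j : ℝ) + 1) * (1 / 2 : ℝ) ^ j * ((k₁ : ℝ) * G k₁) := by ring
      _ ≤ ((j : ℝ) + 1) * (1 / 2 : ℝ) ^ j * C :=
          mul_le_mul_of_nonneg_left henv₁ (by positivity)
      _ ≤ C * ((2 * ((j + 1 : ℕ) : ℝ) + 1) * (1 / 2 : ℝ) ^ (j + 1)) := by
          push_cast
          rw [pow_succ]
          nlinarith [mul_nonneg hp.le hC]

/-- **Head-sum bound.** For a positive sequence `G` with the level envelope `k·G(k) ≤ C` (`k ≥ 1`) and
block halving `G(k + j·b) ≤ 2^{-j}·G(k)` (`1 ≤ k`, `k + j·b ≤ n`, `b ≥ 1`), the head sum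
`∑_{k=1}^{n} k·G(k)` is at most `6·C·b`: bound each term by `C·(2q+1)·2^{-q}`, `q = (k-1)/b`
(`headSum_pointwise`), sum fibrewise over `q` (fibres have `≤ b` elements) and use
`∑_{q<N} (2q+1)·2^{-q} ≤ 6`. [folklore] -/
theorem logConvex_head_sum : ∀ (G : ℕ → ℝ) (C : ℝ) (b n : ℕ), (∀ k, 0 < G k) → 1 ≤ b → (∀ k : ℕ, 1 ≤ k → (k : ℝ) * G k ≤ C) → (∀ k j : ℕ, 1 ≤ k → k + j * b ≤ n → G (k + j * b) ≤ (1 / 2 : ℝ) ^ j * G k) → ∑ k ∈ Finset.Icc 1 n, (k : ℝ) * G k ≤ 6 * C * b := by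
  intro G C b n hG hb henv hhalf
  have hC : 0 ≤ C := by
    have h1 := henv 1 le_rfl
    have h2 := hG 1
    simp only [Nat.cast_one, one_mul] at h1
    linarith
  -- the weights `w q = (2q+1)·2^{-q}` and the number of blocks
  set w : ℕ → ℝ := fun q => (2 * (q : ℝ) + 1) * (1 / 2 : ℝ) ^ q with hw
  have hw0 : ∀ q, 0 ≤ w q := fun q => by rw [hw]; positivity
  set Q : ℕ := (n - 1) / b with hQ
  have hmaps : ∀ k ∈ Finset.Icc 1 n, (k - 1) / b ∈ Finset.range (Q + 1) := by
    intro k hk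
    rw [Finset.mem_Icc] at hk
    exact Finset.mem_range.2 (Nat.lt_succ_of_le (Nat.div_le_div_right (by omega)))
  -- pointwise bound
  have hpt : ∀ k ∈ Finset.Icc 1 n, (k : ℝ) * G k ≤ C * w ((k - 1) / b) := by
    intro k hk
    rw [Finset.mem_Icc] at hk
    have h := headSum_pointwise G C b n k hG hb henv hhalf hk.1 hk.2
    simpa only [hw] using h
  -- each fibre of `k ↦ (k-1)/b` on `Icc 1 n` has at most `b` elements
  have hcard : ∀ q, (Finset.filter (fun k => (k - 1) / b = q) (Finset.Icc 1 n)).card ≤ b := by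
    intro q
    calc (Finset.filter (fun k => (k - 1) / b = q) (Finset.Icc 1 n)).card
        ≤ (Finset.Icc (q * b + 1) (q * b + b)).card := by
          apply Finset.card_le_card
          intro k hk
          rw [Finset.mem_filter, Finset.mem_Icc] at hk
          obtain ⟨⟨hk1, _⟩, hkq⟩ := hk
          have hdm : (k - 1) / b * b + (k - 1) % b = k - 1 := Nat.div_add_mod' (k - 1) b
          have hmod : (k - 1) % b < b := Nat.mod_lt _ (by omega)
          rw [hkq] at hdm
          rw [Finset.mem_Icc]
          constructor <;> omega
      _ = b := by
          rw [Nat.card_Icc]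
          omega
  calc ∑ k ∈ Finset.Icc 1 n, (k : ℝ) * G k
      ≤ ∑ k ∈ Finset.Icc 1 n, C * w ((k - 1) / b) := Finset.sum_le_sum hpt
    _ = ∑ q ∈ Finset.range (Q + 1),
          ∑ k ∈ Finset.Icc 1 n with (k - 1) / b = q, C * w q :=
        (Finset.sum_fiberwise_of_maps_to' hmaps (fun q => C * w q)).symm
    _ ≤ ∑ q ∈ Finset.range (Q + 1), (b : ℝ) * (C * w q) := by
        apply Finset.sum_le_sum
        intro q _
        rw [Finset.sum_const, nsmul_eq_mul]
        exact mul_le_mul_of_nonneg_right (by exact_mod_cast hcard q) (mul_nonneg hC (hw0 q))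
    _ = (b : ℝ) * C * ∑ q ∈ Finset.range (Q + 1), w q := by
        rw [Finset.mul_sum]
        exact Finset.sum_congr rfl fun q _ => by ring
    _ ≤ (b : ℝ) * C * 6 :=
        mul_le_mul_of_nonneg_left (headSum_weight_sum_le (Q + 1)) (mul_nonneg (Nat.cast_nonneg b) hC)
    _ = 6 * C * b := by ring

end Summit.CriticalPhenomena.Ising3DConformalLimit.Cruxes.ExistsScaleCovariantLimit.FoldedCurrentRepulsion
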